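import Mathlib

/-! # The down-set form (UH) of (U) is closed under parallel composition
(seat mine-b, cell pub-perc-repro2; conjectures/MINE-B.md §18.1, §19.3(d))

The g13 Hall form (UH) of the level-summed row (U): with `ν(x) = [r x = 1] − b x·[r x = 0]`, every
LOWER set `D` of the configuration poset has `ν(D) ≥ 0` (`DownDom`) — by Hall's theorem, every
`γ` with `F_R = 0`, `F_B = a` owns `a` private configurations below it with `F_R = 1`.  Under
parallel composition (labels add) there is a pointwise identity

  `ν(x, y) = ν(x)·[r′ y = 0] + [r x = 0]·ν(y)`   (`nu_par_eq`),

so every lower set of the product has `ν`-mass `Σ_{y : r′ y = 0} ν(D^y) + Σ_{x : r x = 0} ν(D_x) ≥ 0`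
(`downDom_par`), and on the whole product the count is exactly `U(X)·Z(Y) + Z(X)·U(Y)`
(`sum_nu_par`, the poset-level `uval_par` of FlowSumClosure.lean).  Series composition of (UH) is
NOT handled this way (it fails for asymmetric labelled posets, MINE-B.md §19.3(d)). -/

namespace Summit.Ventures.PercRepro2.UHClosure

open Finset

variable {X Y : Type*}

/-- The signed weight of (UH): `ν(x) = [r x = 1] − b x·[r x = 0]`. -/
def nu (r b : X → ℕ) (x : X) : ℤ := (if r x = 1 then 1 else 0) - (if r x = 0 then (b x : ℤ) else 0)

/-- Down-set domination (UH): every lower set has non-negative `ν`-mass. -/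
def DownDom [Preorder X] (r b : X → ℕ) : Prop :=
  ∀ D : Finset X, IsLowerSet (↑D : Set X) → 0 ≤ ∑ x ∈ D, nu r b x

/-- **Pointwise identity for the parallel (sum) labels.** -/
theorem nu_par_eq (r b : X → ℕ) (r' b' : Y → ℕ) (x : X) (y : Y) :
    nu (fun p : X × Y => r p.1 + r' p.2) (fun p : X × Y => b p.1 + b' p.2) (x, y)
      = nu r b x * (if r' y = 0 then 1 else 0) + (if r x = 0 then 1 else 0) * nu r' b' y := by
  unfold nu
  simp only
  split_ifs <;> push_cast <;> omega

section fibres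

variable [Preorder X] [Preorder Y] [Fintype X] [Fintype Y] [DecidableEq X] [DecidableEq Y]

/-- membership indicator -/
def ind (D : Finset (X × Y)) (x : X) (y : Y) : ℤ := if (x, y) ∈ D then 1 else 0

omit [Fintype Y] in
/-- the first-coordinate fibre of a lower set is a lower set -/
theorem fibre_fst_isLowerSet (D : Finset (X × Y)) (hD : IsLowerSet (↑D : Set (X × Y))) (y : Y) :
    IsLowerSet (↑(univ.filter (fun x : X => (x, y) ∈ D)) : Set X) := by
  intro x x' hxx' hx
  simp only [coe_filter, mem_univ, true_and, Set.mem_setOf_eq] at hx ⊢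
  exact hD (Prod.mk_le_mk.2 ⟨hxx', le_rfl⟩) hx

omit [Fintype X] in
/-- the second-coordinate fibre of a lower set is a lower set -/
theorem fibre_snd_isLowerSet (D : Finset (X × Y)) (hD : IsLowerSet (↑D : Set (X × Y))) (x : X) :
    IsLowerSet (↑(univ.filter (fun y : Y => (x, y) ∈ D)) : Set Y) := by
  intro y y' hyy' hy
  simp only [coe_filter, mem_univ, true_and, Set.mem_setOf_eq] at hy ⊢
  exact hD (Prod.mk_le_mk.2 ⟨le_rfl, hyy'⟩) hy

omit [Preorder X] [Preorder Y] in
/-- a sum over `D` of a product function, as a double sum with the indicator -/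
theorem sum_D_eq (D : Finset (X × Y)) (f : X → ℤ) (g : Y → ℤ) :
    ∑ p ∈ D, f p.1 * g p.2 = ∑ x, ∑ y, ind D x y * (f x * g y) := by
  rw [← Finset.sum_product' (s := (univ : Finset X)) (t := (univ : Finset Y))
    (f := fun x y => ind D x y * (f x * g y))]
  rw [← Finset.sum_filter_add_sum_filter_not (univ ×ˢ univ) (fun p => p ∈ D)]
  have h1 : ∑ p ∈ (univ ×ˢ univ).filter (fun p : X × Y => p ∈ D),
      ind D p.1 p.2 * (f p.1 * g p.2) = ∑ p ∈ D, f p.1 * g p.2 := by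
    have : (univ ×ˢ univ).filter (fun p : X × Y => p ∈ D) = D := by ext p; simp
    rw [this]
    exact Finset.sum_congr rfl (fun p hp => by simp [ind, hp])
  have h2 : ∑ p ∈ (univ ×ˢ univ).filter (fun p : X × Y => ¬ p ∈ D),
      ind D p.1 p.2 * (f p.1 * g p.2) = 0 := by
    apply Finset.sum_eq_zero
    intro p hp
    simp only [Finset.mem_filter] at hp
    simp [ind, hp.2]
  rw [h1, h2, add_zero]

omit [Fintype Y] in
/-- (UH) of `X` on the fibre over `y` -/
theorem fibre_fst_nonneg (r b : X → ℕ) (hX : DownDom r b) (D : Finset (X × Y))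
    (hD : IsLowerSet (↑D : Set (X × Y))) (y : Y) : 0 ≤ ∑ x, ind D x y * nu r b x := by
  have h := hX (univ.filter (fun x : X => (x, y) ∈ D)) (fibre_fst_isLowerSet D hD y)
  rw [Finset.sum_filter] at h
  have : ∑ x, ind D x y * nu r b x = ∑ x, (if (x, y) ∈ D then nu r b x else 0) := by
    apply Finset.sum_congr rfl; intro x _; unfold ind; split_ifs <;> simp
  rw [this]; exact h

omit [Fintype X] in
/-- (UH) of `Y` on the fibre over `x` -/
theorem fibre_snd_nonneg (r' b' : Y → ℕ) (hY : DownDom r' b') (D : Finset (X × Y))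
    (hD : IsLowerSet (↑D : Set (X × Y))) (x : X) : 0 ≤ ∑ y, ind D x y * nu r' b' y := by
  have h := hY (univ.filter (fun y : Y => (x, y) ∈ D)) (fibre_snd_isLowerSet D hD x)
  rw [Finset.sum_filter] at h
  have : ∑ y, ind D x y * nu r' b' y = ∑ y, (if (x, y) ∈ D then nu r' b' y else 0) := by
    apply Finset.sum_congr rfl; intro y _; unfold ind; split_ifs <;> simp
  rw [this]; exact h

/-- **(UH) is closed under parallel composition** (of arbitrary labelled posets). -/
theorem downDom_par (r b : X → ℕ) (r' b' : Y → ℕ) (hX : DownDom r b) (hY : DownDom r' b') :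
    DownDom (fun p : X × Y => r p.1 + r' p.2) (fun p : X × Y => b p.1 + b' p.2) := by
  intro D hD
  have hpt : ∑ p ∈ D, nu (fun p : X × Y => r p.1 + r' p.2) (fun p : X × Y => b p.1 + b' p.2) p
      = ∑ p ∈ D, nu r b p.1 * (if r' p.2 = 0 then 1 else 0)
        + ∑ p ∈ D, (if r p.1 = 0 then 1 else 0) * nu r' b' p.2 := by
    rw [← Finset.sum_add_distrib]
    exact Finset.sum_congr rfl (fun p _ => nu_par_eq r b r' b' p.1 p.2)
  rw [hpt]
  have h1 : 0 ≤ ∑ p ∈ D, nu r b p.1 * (if r' p.2 = 0 then (1 : ℤ) else 0) := by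
    rw [sum_D_eq D (nu r b) (fun y => if r' y = 0 then 1 else 0), Finset.sum_comm]
    apply Finset.sum_nonneg; intro y _
    have e : ∑ x, ind D x y * (nu r b x * (if r' y = 0 then (1 : ℤ) else 0))
        = (∑ x, ind D x y * nu r b x) * (if r' y = 0 then 1 else 0) := by
      rw [Finset.sum_mul]; apply Finset.sum_congr rfl; intro x _; ring
    rw [e]
    exact mul_nonneg (fibre_fst_nonneg r b hX D hD y) (by split_ifs <;> simp)
  have h2 : 0 ≤ ∑ p ∈ D, (if r p.1 = 0 then (1 : ℤ) else 0) * nu r' b' p.2 := by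
    rw [sum_D_eq D (fun x => if r x = 0 then 1 else 0) (nu r' b')]
    apply Finset.sum_nonneg; intro x _
    have e : ∑ y, ind D x y * ((if r x = 0 then (1 : ℤ) else 0) * nu r' b' y)
        = (if r x = 0 then (1 : ℤ) else 0) * ∑ y, ind D x y * nu r' b' y := by
      rw [Finset.mul_sum]; apply Finset.sum_congr rfl; intro y _; ring
    rw [e]
    exact mul_nonneg (by split_ifs <;> simp) (fibre_snd_nonneg r' b' hY D hD x)
  linarith

omit [Preorder X] [Preorder Y] [DecidableEq X] [DecidableEq Y] in
/-- **The exact count identity**: on the whole product,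
`U(X ∗ Y) = U(X)·Z(Y) + Z(X)·U(Y)` with `Z = #{r = 0}` (no hypothesis). -/
theorem sum_nu_par (r b : X → ℕ) (r' b' : Y → ℕ) :
    ∑ p : X × Y, nu (fun p : X × Y => r p.1 + r' p.2) (fun p : X × Y => b p.1 + b' p.2) p
      = (∑ x, nu r b x) * (∑ y, if r' y = 0 then (1 : ℤ) else 0)
        + (∑ x, if r x = 0 then (1 : ℤ) else 0) * (∑ y, nu r' b' y) := by
  rw [Fintype.sum_prod_type]
  simp only [nu_par_eq, Finset.sum_add_distrib, ← Finset.mul_sum, ← Finset.sum_mul]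

end fibres

end Summit.Ventures.PercRepro2.UHClosure
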